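import Summits.HubbardSuperconductivity.HubbardSuperconductivity.Theses.SeamInduction

/-!
# Route `SeamInduction` — assembly item `Assembly` (stmt-HubbardSuperconductivity-18511)

`SeamInduction.Assembly` (Theses/SeamInduction.lean) is the curried implication
`WidthHaldaneBridge → PerWidthThermodynamics → SeamGluingLocality → HubbardSuperconductivity`
from the route's three cruxes to the summit statement. It is, binder for binder, the type of the
route file's DECIDING THEOREM `SeamInduction.closes` (planner-authored glue elaborated with the
route file: the abstract width induction `key` — per-width data + one-seam locality ⇒ width-uniform
thermodynamics — followed by the parent glue `WidthHaldane.closes`). This file closes the assembly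
item BY NAME with that glue: the theorem below has type literally
`Summit.HubbardSuperconductivity.HubbardSuperconductivity.Theses.SeamInduction.Assembly` and its
proof term is `SeamInduction.closes`. Pure logic over the route's own declarations: no analysis,
no new definitions, no restatement of any item. (The cruxes themselves stay open: `SeamGluingLocality`
carries two `verdict: misstated` notes and `PerWidthThermodynamics` is of open-problem strength —
see the items' evidence; nothing here depends on their truth.)

Source for the order parameter / summit matrix being assembled: D. J. Scalapino, Phys. Rep. 250
(1995) 329, §2; the width-induction architecture follows Lin–Balents–Fisher, Phys. Rev. B 56 (1997) 6569.
-/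

-- the mandated namespace `Summit.<Summit>.<Problem>.Theorems` repeats `HubbardSuperconductivity`
-- (single-problem summit, D-0017), which the `dupNamespace` linter flags on every declaration
set_option linter.dupNamespace false

namespace Summit.HubbardSuperconductivity.HubbardSuperconductivity.Theorems

/-- **Assembly of route `SeamInduction`** (item `stmt-HubbardSuperconductivity-18511`):
`WidthHaldaneBridge → PerWidthThermodynamics → SeamGluingLocality → HubbardSuperconductivity`.
The route's deciding theorem `SeamInduction.closes` takes the three cruxes as named hypotheses and
concludes the sub-problem statement; read as a closed implication it is exactly
`SeamInduction.Assembly`, so the item is closed by the planner's certified glue itself. [folklore] -/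
theorem seamInduction_assembly_proof :
    Summit.HubbardSuperconductivity.HubbardSuperconductivity.Theses.SeamInduction.Assembly :=
  Summit.HubbardSuperconductivity.HubbardSuperconductivity.Theses.SeamInduction.closes

end Summit.HubbardSuperconductivity.HubbardSuperconductivity.Theorems
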